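import Mathlib
import Literature.Geometry.Lorentzian.PseudoRiemannianMetric
import Literature.Geometry.Lorentzian.LeviCivita
import Literature.Geometry.Lorentzian.Isometry
import HarnessLib

/-!
# Charged half-turns: homotopy 4-spheres with involutions preserving no metric of positive scalar curvature

Topic `Literature/Topology/FourManifolds` (summit SmoothPoincare4). One NAMED FACT, no proofs:

* `Kuhrman2025_thm3_chargedHomotopySphere` — there is a smooth homotopy 4-sphere `M` with a smooth
  involution `ι` whose fixed-point set is a smoothly embedded 2-sphere such that NO `ι`-invariant
  Riemannian metric on `M` has everywhere positive scalar curvature (Kuhrman 2025, Thm. 3; the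
  examples are the branched double covers `Σ₂(S⁴, ρK(2,3,|6s+1|))` of `S⁴` along roll-spun torus
  knots — homotopy 4-spheres by Kuhrman's Thm. 1 — and Miyazawa's `Σ₂(S⁴, τ_{0,1}P(−2,3,7))`
  (Miyazawa 2023, Thm. 4.44: simply connected, hence a homotopy `S⁴`), with their branching
  (deck) involutions, whose fixed-point set is the lift of the 2-knot, a smoothly embedded `S²`;
  Miyazawa's real Seiberg–Witten degree of these pairs is `4j ± 1` resp. `3` (Kuhrman §4 with
  Kang–Park–Taniguchi; Miyazawa Thm. 4.32), while an involution preserving a metric of positive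
  scalar curvature on a 4-manifold with `b₊^{−σ} = b₁^{−σ} = 0` and a Real spin structure has
  `|deg| = 1` (Baraglia 2026, Prop. 1.3(3); Miyazawa, proof of Thm. 4.46)).

It grounds `Summit.SmoothPoincare4.SmoothPoincare4.Theses.ChargedHalfTurns.ChargedSphere`
(item stmt-SmoothPoincare4-18212), whose body it repeats verbatim: the supply crux of route
ChargedHalfTurns is stated WITHOUT the invariant (only its positive-scalar-curvature consequence),
so no real Seiberg–Witten theory enters the signature. "Homotopy 4-sphere" is rendered, as in the
summit Statement, by a homotopy equivalence `M ≃ₕ S⁴` of a Hausdorff second-countable smooth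
4-manifold (a closed simply connected 4-manifold with the homology of `S⁴` is homotopy equivalent to
`S⁴` by Whitehead's theorem; Kuhrman and Miyazawa print "homotopy 4-sphere" / "homotopy `S⁴`").
Metrics, Levi-Civita connections, scalar curvature and pull-backs are the tree's
`Literature.Geometry.Lorentzian.PseudoRiemannianMetric` (`IsRiemannian`, `HasLeviCivita`,
`scalarCurvature`) and `Literature.Geometry.Lorentzian.pullbackBilin`; "`ι` preserves `g`" is
`ι^* g = g` pointwise.

Status of the sources: Kuhrman 2025 and Miyazawa 2023 are arXiv preprints (2507.03798,
2312.02041); Baraglia's paper is published (Int. J. Math. 37 (2026)). The fact is vendored as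
printed in Kuhrman's Thm. 3; a retraction of Miyazawa Thm. 4.32/4.44 would void the
`P(−2,3,7)` example but not Kuhrman's `K(2,3,|6s+1|)` family, which rests on Kang–Park–Taniguchi's
computation (arXiv:2405.09295) and Kuhrman's Thm. 1.

## References

* J. Kuhrman, *More exotic `ℝℙ²`-knots and homotopy spheres*, arXiv:2507.03798 (2025), Thm. 3
  (p. 2: "There exist homotopy 4-spheres with involutions … for which Miyazawa's real
  Seiberg–Witten invariant takes all odd positive integer values. These involutions do not
  preserve any positive scalar curvature metric and are not smoothly conjugate to standard
  involutions on `S⁴`"), Thm. 1, §2 (branching involution and its fixed-point set). [Kuhrman2025]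
* J. Miyazawa, *A gauge theoretic invariant of embedded surfaces in 4-manifolds and exotic
  `P²`-knots*, arXiv:2312.02041 (2023), Thm. 4.44, Thm. 4.32, Thm. 4.46 and its proof,
  Prop. 3.14. [Miyazawa2023]
* D. Baraglia, *Exotic embedded surfaces and involutions from Real Seiberg–Witten theory*,
  Int. J. Math. 37 (2026), arXiv:2504.00281, Prop. 1.3(3). [Baraglia2026]
-/

noncomputable section

open Set Function
open scoped Manifold ContDiff Topology ContinuousMap

namespace Literature.Topology.FourManifolds

/-- **Charged half-turns exist** (Kuhrman 2025, Thm. 3: "There exist homotopy 4-spheres with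
involutions … for which Miyazawa's real Seiberg–Witten invariant takes all odd positive integer
values. These involutions do not preserve any positive scalar curvature metric and are not smoothly
conjugate to standard involutions on `S⁴`"; the involutions are the branching involutions of the
double covers `Σ₂(S⁴, ρK(2,3,|6s+1|))`, homotopy 4-spheres by Thm. 1, with fixed-point set the
lifted 2-knot, §2; likewise Miyazawa 2023, Thm. 4.44 + Thm. 4.32 + proof of Thm. 4.46 for
`Σ₂(S⁴, τ_{0,1}P(−2,3,7))`, `|deg| = 3`, and Baraglia 2026, Prop. 1.3(3): an involution preserving
a positive-scalar-curvature metric has `|deg| = 1`). LEAN STATEMENT: there are a Hausdorff,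
second-countable smooth (`C^∞`, model `𝓡 4`) 4-manifold `M` homotopy equivalent to the unit sphere
`S⁴ ⊂ ℝ⁵`, a smooth involution `ι : M → M` and a smooth embedding `e : S² → M` with
`Fix(ι) = range e`, such that for every Riemannian metric `g` on `M` with a Levi-Civita connection
and everywhere positive scalar curvature, `ι^* g ≠ g`. Verbatim the body of the route item
`Summit.SmoothPoincare4.SmoothPoincare4.Theses.ChargedHalfTurns.ChargedSphere`, which it grounds
(item = fact). Sources are preprints except Baraglia 2026; see the module docstring.
[cite: Kuhrman2025, Thm. 3] [cite: Miyazawa2023, Thm. 4.44, Thm. 4.32 and proof of Thm. 4.46]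
[cite: Baraglia2026, Prop. 1.3(3)] -/
def Kuhrman2025_thm3_chargedHomotopySphere : Prop :=
  ∃ (M : Type) (_ : TopologicalSpace M) (_ : T2Space M) (_ : SecondCountableTopology M)
    (_ : ChartedSpace (EuclideanSpace ℝ (Fin 4)) M) (_ : IsManifold (𝓡 4) ((⊤ : ℕ∞) : WithTop ℕ∞) M)
    (_ : M ≃ₕ Metric.sphere (0 : EuclideanSpace ℝ (Fin 5)) 1) (ι : M → M)
    (e : Metric.sphere (0 : EuclideanSpace ℝ (Fin 3)) 1 → M),
    ContMDiff (𝓡 4) (𝓡 4) ((⊤ : ℕ∞) : WithTop ℕ∞) ι ∧ ι ∘ ι = id ∧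
    Manifold.IsSmoothEmbedding (𝓡 2) (𝓡 4) ((⊤ : ℕ∞) : WithTop ℕ∞) e ∧
    (∀ x, ι x = x ↔ x ∈ Set.range e) ∧
    ∀ (g : Literature.Geometry.Lorentzian.PseudoRiemannianMetric (𝓡 4) ((⊤ : ℕ∞) : WithTop ℕ∞)
        (EuclideanSpace ℝ (Fin 4)) (TangentSpace (𝓡 4) : M → Type _)) (_ : g.HasLeviCivita),
      g.IsRiemannian → (∀ x, 0 < g.scalarCurvature x) →
        ¬ (∀ y, Literature.Geometry.Lorentzian.pullbackBilin (I := 𝓡 4) (I' := 𝓡 4) ι g.val y = g.val y)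

end Literature.Topology.FourManifolds

end
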